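import Mathlib
import Summits.ValiantsHypothesis.ValiantsHypothesis.Theorems.ValuativeGCTValuativeFlipRayFromBottom
import Summits.ValiantsHypothesis.ValiantsHypothesis.Theorems.ValuativeGCTValuativeFlipPaddingTransfer
import Summits.ValiantsHypothesis.ValiantsHypothesis.Theorems.ValuativeGCTValuativeFlipEvalCertificates
import HarnessLib

/-!
# `ValuativeGCT.ValuativeFlip` (stmt-ValiantsHypothesis-12624): rays from the bottom, IV —
# twisted certificates of FULL size, and the effective count of off-stable paddings

Wall-breaker k4 (gen 1, seat 2; axis "representation-stability transfer between `m` and `m + 1`"),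
helper file `--supports stmt-ValiantsHypothesis-12624`.  Letters as in Part III (`…RayFromBottom`):
`n ≤ m`, `λ ⊢ m·δ` with `≤ m²` parts and `λ₂ ≤ m`, `P(j) = mult_{(λ♯(m+j))*} ℂ[Δ_{m+j}(X₀₀^{m+j-n} per_n)]`,
`a = a_λ(δ[m])`, `H = HWV_{λ*}(ℂ[Sym^m ℂ^{m²}])`, `K_j(λ)` the twisted kernel at level `m`.

Consequences of the identity `P(j) + dim K_j(λ) = a` (`orbitMultiplicity_rowLift_add_finrank_twistKer`):

* `finrank_range_twistEval_eq` — the Δ_j-twisted evaluation map `Ψ_j : H → (column-normalised points → ℂ)`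
  has RANK EXACTLY `P(j)`.
* `le_orbitMultiplicity_rowLift_of_twistedDet_ne_zero` — a nonsingular `D × D` twisted evaluation
  matrix `(F_i(Δ_j(A_l · X₀₀^{m-n} per_n)))` with `F_i ∈ H` and column-normalised `A_l` gives `D ≤ P(j)`:
  twisted inheritance (k12 `stub_twistedInheritance` at `m = n`, k4g1 `twistedInheritance_padded` above)
  RE-DERIVED from the identity by linear algebra alone, uniformly in `n ≤ m`.
* `exists_twistedCertificate_full` — **conversely, a nonsingular twisted certificate of the FULL size
  `D = P(j)` exists at level `m` for every `j`** (the rank is attained on finitely many points,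
  `exists_det_eval_ne_zero_of_linearIndependent`).  Twisted level-`m` certificates compute the per
  side of every ray position exactly.
* `ray_offStable_finite_ncard_le` — **EFFECTIVE RAY STABILITY FROM THE BOTTOM**: there is ONE value
  `P⋆(λ) ≤ a` with `P(j) ≤ P⋆` for every `j`, attained, and
  **`{j : P(j) ≠ P⋆}` is FINITE with at most `m·δ·P⋆` elements**: at a padding `j⋆` attaining the maximum
  take a full twisted certificate at level `m`; its determinant is `(j!)^{δP⋆} q(j)` for ONE polynomial `q`
  of degree `≤ P⋆·δ·m` (k4g1 `exists_twistedDet_poly`), nonzero at `j⋆`; wherever `q(j) ≠ 0` the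
  certificate gives `P(j) ≥ P⋆`.  (k16's `per_rayStable` gave eventual constancy with `P ≤ P∞` and no
  count; k4g1's `paddingTransfer_exceptions_ncard_le` counted only the drops below the BOTTOM value `P(0)`.)
* `ray_eventualValue_eq_max` — hence every eventual value of the ray (k16's `P∞(λ)`) is this maximum `P⋆(λ)`.

Sources: BLMW, SIAM J. Comput. 40 (2011) §6.4; Ikenmeyer–Panova 2017 Prop. 2.6(b); Bürgisser–Ikenmeyer–Panova
2019 §5; this crux's Parts I–III and k4g1/k12/k16 files cited above.
-/

set_option linter.dupNamespace false

namespace Summit.ValiantsHypothesis.ValiantsHypothesis.Theorems.ValuativeFlip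

open scoped BigOperators Nat Matrix
open MvPolynomial
open Literature.NumberTheory.DiophantineGeometry
open Literature.Computability.AlgebraicComplexity
open Literature.Computability.Complexity

noncomputable section

/-! ## The twisted evaluation map has rank exactly `P(j)` -/

/-- **Rank of the twisted evaluation map.**  For `n ≤ m`, `λ ⊢ m·δ` (`≤ m²` parts, `λ₂ ≤ m`) and every `j`,
the linear map `Ψ_j : H → (X → ℂ)`, `G ↦ (A ↦ G(Δ_j(A · X₀₀^{m-n} per_n)))` on the set `X` of
column-normalised matrices, has `dim range Ψ_j = P(j)` (its kernel is the twisted kernel `K_j(λ)`;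
identity of Part III and rank–nullity). [this crux, Part III] -/
theorem finrank_range_twistEval_eq {n m δ : ℕ} [NeZero m] (hnm : n ≤ m)
    (lam : Nat.Partition (m * δ)) (hlam : lam.parts.card ≤ m * m) (h₂ : lam.sortedParts.getD 1 0 ≤ m)
    (j : ℕ) [NeZero (m + j)] :
    Module.finrank ℂ ↥(LinearMap.range ((LinearMap.pi fun A :
        {A : Matrix (MatIdx m) (MatIdx m) ℂ //
          n < m → ∀ s, A s (toLex ((0 : Fin m), (0 : Fin m))) = if s = topMatIdx m then 1 else 0} =>
        (aeval (R := ℂ) (S₁ := ℂ) fun e : DegIdx (MatIdx m) m =>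
          (((e.1 (topMatIdx m) + j).descFactorial j : ℕ) : ℂ) *
            coeff e.1 (linSubst (MatIdx m) ℂ A.1 (paddedPerFormLex ℂ n m))).toLinearMap).comp
        (highestWeightSpace (coordRep (MatIdx m) ℂ m) (partitionWeightLex m lam)).subtype)) =
      orbitMultiplicity ℂ (paddedPerFormLex ℂ n (m + j)) (m + j) (partitionWeightLex (m + j) (rowLift lam j)) := by
  set H := highestWeightSpace (coordRep (MatIdx m) ℂ m) (partitionWeightLex m lam) with hH
  haveI : FiniteDimensional ℂ ↥H := finiteDimensional_highestWeightSpace_coordRep_holds (NeZero.ne m) _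
  set Ψ := (LinearMap.pi fun A :
      {A : Matrix (MatIdx m) (MatIdx m) ℂ //
        n < m → ∀ s, A s (toLex ((0 : Fin m), (0 : Fin m))) = if s = topMatIdx m then 1 else 0} =>
      (aeval (R := ℂ) (S₁ := ℂ) fun e : DegIdx (MatIdx m) m =>
        (((e.1 (topMatIdx m) + j).descFactorial j : ℕ) : ℂ) *
          coeff e.1 (linSubst (MatIdx m) ℂ A.1 (paddedPerFormLex ℂ n m))).toLinearMap).comp H.subtype with hΨ
  -- the kernel of `Ψ` is the twisted kernel, seen inside `H`
  have hker : LinearMap.ker Ψ = Submodule.comap H.subtype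
      (⨅ (A : Matrix (MatIdx m) (MatIdx m) ℂ)
        (_ : n < m → ∀ s, A s (toLex ((0 : Fin m), (0 : Fin m))) = if s = topMatIdx m then 1 else 0),
        LinearMap.ker (aeval (R := ℂ) (S₁ := ℂ) fun e : DegIdx (MatIdx m) m =>
          (((e.1 (topMatIdx m) + j).descFactorial j : ℕ) : ℂ) *
            coeff e.1 (linSubst (MatIdx m) ℂ A (paddedPerFormLex ℂ n m))).toLinearMap) := by
    ext G
    simp only [hΨ, LinearMap.mem_ker, LinearMap.coe_comp, Function.comp_apply, Submodule.coe_subtype,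
      Submodule.mem_comap, Submodule.mem_iInf, AlgHom.toLinearMap_apply, funext_iff, LinearMap.pi_apply,
      Pi.zero_apply, Subtype.forall]
  have hrn := LinearMap.finrank_range_add_finrank_ker Ψ
  have hkf : Module.finrank ℂ ↥(LinearMap.ker Ψ) = Module.finrank ℂ ↥(H ⊓
      ⨅ (A : Matrix (MatIdx m) (MatIdx m) ℂ)
        (_ : n < m → ∀ s, A s (toLex ((0 : Fin m), (0 : Fin m))) = if s = topMatIdx m then 1 else 0),
        LinearMap.ker (aeval (R := ℂ) (S₁ := ℂ) fun e : DegIdx (MatIdx m) m =>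
          (((e.1 (topMatIdx m) + j).descFactorial j : ℕ) : ℂ) *
            coeff e.1 (linSubst (MatIdx m) ℂ A (paddedPerFormLex ℂ n m))).toLinearMap) := by
    rw [hker, ← Submodule.finrank_map_subtype_eq H, Submodule.map_comap_subtype]
  have hid := orbitMultiplicity_rowLift_add_finrank_twistKer hnm lam hlam h₂ j
  rw [← hH] at hid
  have hHa : Module.finrank ℂ ↥H = plethysmCoeff ℂ (MatIdx m) m (partitionWeightLex m lam) := rfl
  omega

/-! ## Twisted certificates: sufficiency re-derived, and FULL-size certificates exist -/

/-- **Twisted inheritance from the identity.**  For `n ≤ m`, `λ ⊢ m·δ` (`≤ m²` parts, `λ₂ ≤ m`), `j`,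
highest-weight vectors `F₁ … F_D ∈ HWV_{λ*}` and column-normalised `A₁ … A_D ∈ Mat_{m²}`: if the
Δ_j-twisted evaluation matrix `(F_i(Δ_j(A_l · X₀₀^{m-n} per_n)))_{i,l}` is nonsingular then `D ≤ P(j)` —
the `Ψ_j(F_i)` are independent, so `D ≤ rank Ψ_j = P(j)`.  (Uniform in `n ≤ m`; for `λ₂ > m` use
`stub_twistedInheritance` / `twistedInheritance_padded`.) [this file] -/
theorem le_orbitMultiplicity_rowLift_of_twistedDet_ne_zero {n m δ : ℕ} [NeZero m] (hnm : n ≤ m)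
    (lam : Nat.Partition (m * δ)) (hlam : lam.parts.card ≤ m * m) (h₂ : lam.sortedParts.getD 1 0 ≤ m)
    (j : ℕ) [NeZero (m + j)] {D : ℕ} (F : Fin D → MvPolynomial (DegIdx (MatIdx m) m) ℂ)
    (hF : ∀ i, F i ∈ highestWeightSpace (coordRep (MatIdx m) ℂ m) (partitionWeightLex m lam))
    (A : Fin D → Matrix (MatIdx m) (MatIdx m) ℂ)
    (hA : ∀ l, n < m → ∀ s, A l s (toLex ((0 : Fin m), (0 : Fin m))) = if s = topMatIdx m then 1 else 0)
    (hdet : (Matrix.of fun i l : Fin D => aeval (fun e : DegIdx (MatIdx m) m =>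
      (((e.1 (topMatIdx m) + j).descFactorial j : ℕ) : ℂ) *
        coeff e.1 (linSubst (MatIdx m) ℂ (A l) (paddedPerFormLex ℂ n m))) (F i)).det ≠ 0) :
    D ≤ orbitMultiplicity ℂ (paddedPerFormLex ℂ n (m + j)) (m + j) (partitionWeightLex (m + j) (rowLift lam j)) := by
  classical
  set H := highestWeightSpace (coordRep (MatIdx m) ℂ m) (partitionWeightLex m lam) with hH
  haveI : FiniteDimensional ℂ ↥H := finiteDimensional_highestWeightSpace_coordRep_holds (NeZero.ne m) _
  set Ψ := (LinearMap.pi fun A :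
      {A : Matrix (MatIdx m) (MatIdx m) ℂ //
        n < m → ∀ s, A s (toLex ((0 : Fin m), (0 : Fin m))) = if s = topMatIdx m then 1 else 0} =>
      (aeval (R := ℂ) (S₁ := ℂ) fun e : DegIdx (MatIdx m) m =>
        (((e.1 (topMatIdx m) + j).descFactorial j : ℕ) : ℂ) *
          coeff e.1 (linSubst (MatIdx m) ℂ A.1 (paddedPerFormLex ℂ n m))).toLinearMap).comp H.subtype with hΨ
  rw [← finrank_range_twistEval_eq hnm lam hlam h₂ j]
  -- the images `Ψ(F_i)` are linearly independent
  have hli : LinearIndependent ℂ fun i : Fin D => Ψ ⟨F i, hF i⟩ := by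
    rw [Fintype.linearIndependent_iff]
    intro c hc i
    have hvec : c ᵥ* (Matrix.of fun i l : Fin D => aeval (fun e : DegIdx (MatIdx m) m =>
        (((e.1 (topMatIdx m) + j).descFactorial j : ℕ) : ℂ) *
          coeff e.1 (linSubst (MatIdx m) ℂ (A l) (paddedPerFormLex ℂ n m))) (F i)) = 0 := by
      funext l
      have h1 := congr_fun hc ⟨A l, hA l⟩
      rw [Finset.sum_apply] at h1
      simp only [Pi.smul_apply, smul_eq_mul, Pi.zero_apply] at h1
      rw [Pi.zero_apply, ← h1]
      rfl
    exact congr_fun (Matrix.eq_zero_of_vecMul_eq_zero hdet hvec) i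
  have hli' : LinearIndependent ℂ fun i : Fin D =>
      (⟨Ψ ⟨F i, hF i⟩, LinearMap.mem_range_self Ψ _⟩ : ↥(LinearMap.range Ψ)) :=
    LinearIndependent.of_comp (LinearMap.range Ψ).subtype hli
  have h := hli'.fintype_card_le_finrank
  rw [Fintype.card_fin] at h
  exact h

/-- **Full-size twisted certificates exist at level `m`.**  For `n ≤ m`, `λ ⊢ m·δ` (`≤ m²` parts,
`λ₂ ≤ m`) and every `j` there are `D = P(j)` highest-weight vectors `F_i ∈ HWV_{λ*}` on `ℂ[Sym^m ℂ^{m²}]`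
and `D` column-normalised matrices `A_l ∈ Mat_{m²}` whose Δ_j-twisted evaluation matrix is nonsingular
(rank `P(j)` of `Ψ_j`, `finrank_range_twistEval_eq`, attained on points by
`exists_det_eval_ne_zero_of_linearIndependent`).  The per side of EVERY ray position is certified,
exactly, at level `m`. [this file; k12 `…EvalCertificates`] -/
theorem exists_twistedCertificate_full {n m δ : ℕ} [NeZero m] (hnm : n ≤ m)
    (lam : Nat.Partition (m * δ)) (hlam : lam.parts.card ≤ m * m) (h₂ : lam.sortedParts.getD 1 0 ≤ m)
    (j : ℕ) [NeZero (m + j)] :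
    ∃ (F : Fin (orbitMultiplicity ℂ (paddedPerFormLex ℂ n (m + j)) (m + j) (partitionWeightLex (m + j) (rowLift lam j))) →
          MvPolynomial (DegIdx (MatIdx m) m) ℂ)
      (A : Fin (orbitMultiplicity ℂ (paddedPerFormLex ℂ n (m + j)) (m + j) (partitionWeightLex (m + j) (rowLift lam j))) →
          Matrix (MatIdx m) (MatIdx m) ℂ),
      (∀ i, F i ∈ highestWeightSpace (coordRep (MatIdx m) ℂ m) (partitionWeightLex m lam)) ∧
      (∀ l, n < m → ∀ s, A l s (toLex ((0 : Fin m), (0 : Fin m))) = if s = topMatIdx m then 1 else 0) ∧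
      (Matrix.of fun i l => aeval (fun e : DegIdx (MatIdx m) m =>
        (((e.1 (topMatIdx m) + j).descFactorial j : ℕ) : ℂ) *
          coeff e.1 (linSubst (MatIdx m) ℂ (A l) (paddedPerFormLex ℂ n m))) (F i)).det ≠ 0 := by
  classical
  set D := orbitMultiplicity ℂ (paddedPerFormLex ℂ n (m + j)) (m + j) (partitionWeightLex (m + j) (rowLift lam j)) with hD
  set H := highestWeightSpace (coordRep (MatIdx m) ℂ m) (partitionWeightLex m lam) with hH
  haveI : FiniteDimensional ℂ ↥H := finiteDimensional_highestWeightSpace_coordRep_holds (NeZero.ne m) _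
  set Ψ := (LinearMap.pi fun A :
      {A : Matrix (MatIdx m) (MatIdx m) ℂ //
        n < m → ∀ s, A s (toLex ((0 : Fin m), (0 : Fin m))) = if s = topMatIdx m then 1 else 0} =>
      (aeval (R := ℂ) (S₁ := ℂ) fun e : DegIdx (MatIdx m) m =>
        (((e.1 (topMatIdx m) + j).descFactorial j : ℕ) : ℂ) *
          coeff e.1 (linSubst (MatIdx m) ℂ A.1 (paddedPerFormLex ℂ n m))).toLinearMap).comp H.subtype with hΨ
  have hr : Module.finrank ℂ ↥(LinearMap.range Ψ) = D := finrank_range_twistEval_eq hnm lam hlam h₂ j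
  -- a basis of the range, read as `D` independent functions on the points
  let b := Module.finBasisOfFinrankEq ℂ ↥(LinearMap.range Ψ) hr
  have hli : LinearIndependent ℂ fun i : Fin D => ((b i : ↥(LinearMap.range Ψ)) :
      {A : Matrix (MatIdx m) (MatIdx m) ℂ //
        n < m → ∀ s, A s (toLex ((0 : Fin m), (0 : Fin m))) = if s = topMatIdx m then 1 else 0} → ℂ) :=
    b.linearIndependent.map' (LinearMap.range Ψ).subtype (Submodule.ker_subtype _)
  obtain ⟨x, hx⟩ := exists_det_eval_ne_zero_of_linearIndependent D _ hli
  -- preimages in `H`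
  have hpre := fun i : Fin D => LinearMap.mem_range.mp (b i).2
  choose G hG using hpre
  refine ⟨fun i => (G i : MvPolynomial (DegIdx (MatIdx m) m) ℂ), fun l => (x l).1, fun i => (G i).2,
    fun l => (x l).2, ?_⟩
  have hmat : (Matrix.of fun i l : Fin D => aeval (fun e : DegIdx (MatIdx m) m =>
      (((e.1 (topMatIdx m) + j).descFactorial j : ℕ) : ℂ) *
        coeff e.1 (linSubst (MatIdx m) ℂ (x l).1 (paddedPerFormLex ℂ n m))) (G i : MvPolynomial (DegIdx (MatIdx m) m) ℂ)) =
      Matrix.of fun i l : Fin D => ((b i : ↥(LinearMap.range Ψ)) : _ → ℂ) (x l) := by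
    ext i l
    simp only [Matrix.of_apply]
    rw [← hG i]
    rfl
  rw [hmat]
  exact hx

/-! ## Effective ray stability from the bottom -/

/-- **EFFECTIVE RAY STABILITY FROM THE BOTTOM.**  For `n ≤ m`, `m ≥ 1`, `λ ⊢ m·δ` with at most `m²`
parts and `λ₂ ≤ m`, there is ONE value `P⋆ ≤ a_λ(δ[m])` of the ray `j ↦ P(j) = mult_{(λ♯(m+j))*}
ℂ[Δ_{m+j}(X₀₀^{m+j-n} per_n)]` such that `P(j) ≤ P⋆` for EVERY `j`, `P⋆` is attained, and the set of
paddings with `P(j) ≠ P⋆` is FINITE with at most `m·δ·P⋆` elements.  Proof: `P ≤ a` (Part III) gives a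
maximum `P⋆ = P(j⋆)`; a full twisted certificate at `j⋆` (level `m`, `exists_twistedCertificate_full`) has
determinant `(j!)^{δP⋆} q(j)` along the ray for one polynomial `q`, `deg q ≤ P⋆·δ·m`, `q(j⋆) ≠ 0`
(`exists_twistedDet_poly`, k4g1); off the natural roots of `q` it certifies `P(j) ≥ P⋆`.
[BLMW 2011 §6.4; Ikenmeyer–Panova 2017 Prop. 2.6(b); this crux, Parts I–III] -/
theorem ray_offStable_finite_ncard_le {n m δ : ℕ} [NeZero m] (hnm : n ≤ m)
    (lam : Nat.Partition (m * δ)) (hlam : lam.parts.card ≤ m * m) (h₂ : lam.sortedParts.getD 1 0 ≤ m) :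
    ∃ P : ℕ, P ≤ plethysmCoeff ℂ (MatIdx m) m (partitionWeightLex m lam) ∧
      (∀ (j : ℕ) [NeZero (m + j)],
        orbitMultiplicity ℂ (paddedPerFormLex ℂ n (m + j)) (m + j) (partitionWeightLex (m + j) (rowLift lam j)) ≤ P) ∧
      (∃ (j : ℕ) (_ : NeZero (m + j)),
        orbitMultiplicity ℂ (paddedPerFormLex ℂ n (m + j)) (m + j) (partitionWeightLex (m + j) (rowLift lam j)) = P) ∧
      {j : ℕ | ∀ [NeZero (m + j)],
        orbitMultiplicity ℂ (paddedPerFormLex ℂ n (m + j)) (m + j) (partitionWeightLex (m + j) (rowLift lam j)) ≠ P}.Finite ∧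
      {j : ℕ | ∀ [NeZero (m + j)],
        orbitMultiplicity ℂ (paddedPerFormLex ℂ n (m + j)) (m + j) (partitionWeightLex (m + j) (rowLift lam j)) ≠ P}.ncard ≤
        m * δ * P := by
  classical
  have hm0 : m ≠ 0 := NeZero.ne m
  -- the ray as an instance-free function of `j`
  let Pf : ℕ → ℕ := fun j =>
    haveI : NeZero (m + j) := ⟨by omega⟩
    orbitMultiplicity ℂ (paddedPerFormLex ℂ n (m + j)) (m + j) (partitionWeightLex (m + j) (rowLift lam j))
  have hPf : ∀ (j : ℕ) [NeZero (m + j)],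
      orbitMultiplicity ℂ (paddedPerFormLex ℂ n (m + j)) (m + j) (partitionWeightLex (m + j) (rowLift lam j)) = Pf j :=
    fun j _ => rfl
  set a := plethysmCoeff ℂ (MatIdx m) m (partitionWeightLex m lam) with ha
  have hbound : ∀ j, Pf j ≤ a := by
    intro j
    haveI : NeZero (m + j) := ⟨by omega⟩
    have h := orbitMultiplicity_rowLift_add_finrank_twistKer hnm lam hlam h₂ j
    rw [hPf j] at h
    omega
  -- the maximum over the ray
  have hne : (Set.range Pf).Nonempty := ⟨Pf 0, 0, rfl⟩
  have hbdd : BddAbove (Set.range Pf) := ⟨a, by rintro _ ⟨j, rfl⟩; exact hbound j⟩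
  obtain ⟨jm, hjm⟩ : sSup (Set.range Pf) ∈ Set.range Pf := Nat.sSup_mem hne hbdd
  set P := sSup (Set.range Pf) with hP
  have hle : ∀ j, Pf j ≤ P := fun j => le_csSup hbdd ⟨j, rfl⟩
  haveI hjmI : NeZero (m + jm) := ⟨by omega⟩
  -- a full twisted certificate at the maximum
  obtain ⟨F, A, hF, hAcol, hdet⟩ := exists_twistedCertificate_full hnm lam hlam h₂ jm
  have hDP : orbitMultiplicity ℂ (paddedPerFormLex ℂ n (m + jm)) (m + jm)
      (partitionWeightLex (m + jm) (rowLift lam jm)) = P := by rw [hPf jm]; exact hjm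
  have hhom : ∀ i, (F i).IsHomogeneous δ := fun i =>
    isHomogeneous_of_mem_highestWeightSpace hm0 (hF i) (size_partitionWeightLex' lam hlam)
  have ht : ∀ e : DegIdx (MatIdx m) m, e.1 (topMatIdx m) ≤ m := by
    intro e
    have he : e.1.degree = m := mem_degMonomials_iff.mp e.2
    exact (Finsupp.le_degree _ _).trans he.le
  obtain ⟨q, hqdeg, -, hqj⟩ := exists_twistedDet_poly (fun e : DegIdx (MatIdx m) m => e.1 (topMatIdx m))
    F hhom ht (fun l e => coeff e.1 (linSubst (MatIdx m) ℂ (A l) (paddedPerFormLex ℂ n m)))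
  have hqjm : q.eval (jm : ℂ) ≠ 0 := by
    intro h0
    apply hdet
    have := hqj jm
    rw [h0, mul_zero] at this
    exact this
  have hq : q ≠ 0 := fun h => hqjm (by rw [h, Polynomial.eval_zero])
  -- off the roots of `q` the ray takes the value `P`
  have hval : ∀ j : ℕ, q.eval (j : ℂ) ≠ 0 → Pf j = P := by
    intro j hj
    haveI : NeZero (m + j) := ⟨by omega⟩
    refine le_antisymm (hle j) ?_
    rw [← hPf j, ← hDP]
    refine le_orbitMultiplicity_rowLift_of_twistedDet_ne_zero hnm lam hlam h₂ j F hF A hAcol ?_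
    rw [hqj j]
    refine mul_ne_zero (pow_ne_zero _ (pow_ne_zero _ ?_)) hj
    exact_mod_cast Nat.factorial_ne_zero j
  have hsub : {j : ℕ | ∀ [NeZero (m + j)],
      orbitMultiplicity ℂ (paddedPerFormLex ℂ n (m + j)) (m + j) (partitionWeightLex (m + j) (rowLift lam j)) ≠ P} ⊆
      {j : ℕ | q.eval (j : ℂ) = 0} := by
    intro j hj
    by_contra hne'
    haveI : NeZero (m + j) := ⟨by omega⟩
    exact hj (by rw [hPf j]; exact hval j hne')
  have hfin : {j : ℕ | q.eval (j : ℂ) = 0}.Finite :=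
    (Polynomial.finite_setOf_isRoot hq).preimage Nat.cast_injective.injOn
  refine ⟨P, by rw [← hjm]; exact hbound jm, fun j _ => by rw [hPf j]; exact hle j,
    ⟨jm, hjmI, by rw [hPf jm]; exact hjm⟩, hfin.subset hsub, ?_⟩
  calc _ ≤ {j : ℕ | q.eval (j : ℂ) = 0}.ncard := Set.ncard_le_ncard hsub hfin
    _ ≤ q.natDegree := ncard_natRoots_le q hq
    _ ≤ orbitMultiplicity ℂ (paddedPerFormLex ℂ n (m + jm)) (m + jm)
          (partitionWeightLex (m + jm) (rowLift lam jm)) * (δ * m) := hqdeg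
    _ = m * δ * P := by rw [hDP]; ring

/-- **Every eventual value of the ray is its maximum.**  In the situation of
`ray_offStable_finite_ncard_le`, if `P(j) = P'` for all `j ≥ j₀` then `P' = P⋆` (the off-stable set is
finite).  So k16's stable value `P∞(λ)` is `max_j P(j)`, attained, computable at level `m` as
`a_λ(δ[m]) − min_j dim K_j(λ)`, and missed at at most `m·δ·P∞` paddings. [this file; k16 `per_rayStable`] -/
theorem ray_eventualValue_eq_max {n m δ : ℕ} [NeZero m] (hnm : n ≤ m)
    (lam : Nat.Partition (m * δ)) (hlam : lam.parts.card ≤ m * m) (h₂ : lam.sortedParts.getD 1 0 ≤ m)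
    {P' j₀ : ℕ} (hP' : ∀ (j : ℕ), j₀ ≤ j → ∀ [NeZero (m + j)],
      orbitMultiplicity ℂ (paddedPerFormLex ℂ n (m + j)) (m + j) (partitionWeightLex (m + j) (rowLift lam j)) = P') :
    ∃ P : ℕ, P' = P ∧
      (∀ (j : ℕ) [NeZero (m + j)],
        orbitMultiplicity ℂ (paddedPerFormLex ℂ n (m + j)) (m + j) (partitionWeightLex (m + j) (rowLift lam j)) ≤ P) ∧
      {j : ℕ | ∀ [NeZero (m + j)],
        orbitMultiplicity ℂ (paddedPerFormLex ℂ n (m + j)) (m + j) (partitionWeightLex (m + j) (rowLift lam j)) ≠ P}.ncard ≤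
        m * δ * P := by
  have hm0 : m ≠ 0 := NeZero.ne m
  obtain ⟨P, -, hle, -, hfin, hcard⟩ := ray_offStable_finite_ncard_le hnm lam hlam h₂
  refine ⟨P, ?_, hle, hcard⟩
  -- a padding beyond `j₀` and beyond the finite off-stable set
  obtain ⟨B, hB⟩ := hfin.bddAbove
  set j := max j₀ (B + 1) with hj
  haveI : NeZero (m + j) := ⟨by omega⟩
  have h1 := hP' j (le_max_left _ _)
  have h2 : ¬ j ∈ {j : ℕ | ∀ [NeZero (m + j)],
      orbitMultiplicity ℂ (paddedPerFormLex ℂ n (m + j)) (m + j) (partitionWeightLex (m + j) (rowLift lam j)) ≠ P} := by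
    intro hmem
    have := hB hmem
    omega
  simp only [Set.mem_setOf_eq, not_forall, not_not] at h2
  obtain ⟨inst, h3⟩ := h2
  rw [← h1]
  exact h3

end

end Summit.ValiantsHypothesis.ValiantsHypothesis.Theorems.ValuativeFlip
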